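import Summits.QuantumFields.YangMills.Theses.XiPowWidening

/-!
# Route `XiPowWidening` (QuantumFields / YangMills; rung-R2ξ leaf `WeakCouplingRates.XiPow`, all compact simple `G`) —
# support item `FloorOfRigidityAndWitnessG` (stmt-QuantumFields-22469), PROVED

The arithmetic glue, per `(G, r)`: RIGIDITY `(A, C, q, a)` (any two translation-invariant DLR probability states have the
same connected (1,2)-plaquette-cost time correlator up to `C n^q β^(−a)`, `a > 2`, on `1 ≤ n ≤ 2β^A`) + WITNESS
`(A', κ, p)` (some translation-invariant DLR probability state has the floor `κ β^(−2) n^(−p)` on `1 ≤ n ≤ 2β^{A'}`) +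
«torus limit points are translation-invariant DLR states» ⇒ every limit point has the floor `(κ/2) β^(−2) n^(−p)` on the
window `1 ≤ n ≤ 2β^{A''}`, `A'' = min (A, A', (a − 2)/(2(p + q + 1)))`, for `β` beyond an explicit threshold.

THE ARGUMENT.  In that window `n^{p+q} ≤ 2^{p+q} β^{(a−2)/2}`, so once `β^{(a−2)/2} ≥ 2^{p+q+1} C₁/κ` (`C₁ = max C 1`)
the rigidity error `C₁ n^q β^(−a)` is at most half the floor `κ β^(−2) n^(−p)`
(`xiPowWidening_rigidity_error_le_half_floor`); subtract.

Provenance: the proof is the planner's birth-certificate artefact (ym-idea-1 g0, `bc/XiPowWidening_supports.lean`,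
attached as evidence on the item 2026-08-27), landed verbatim up to the tree's naming conventions.

WHAT THIS IS NOT: not a proof of the route's cruxes `CorrelatorRigidityG` (r2) / `WitnessStateFloorG` (r3), not a mass
gap, not Clay — the route bears on the RECORD rung R2ξ (an UPPER bound on the gap) and no summit is proved by it.
-/

namespace Summit.QuantumFields.YangMills.Theorems

open MeasureTheory Filter Topology
open Literature.MathematicalPhysics.QuantumFieldTheory
open Literature.MathematicalPhysics.QuantumLattice
open Summit.QuantumFields.YangMills.Theorems.WeakCouplingRates

/-- The arithmetic heart of stmt-QuantumFields-22469: in the window `n ≤ 2β^{A''}` with `A''(p+q) ≤ (a-2)/2` and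
`β^{(a-2)/2} ≥ 2^{p+q+1} C₁/κ`, the rigidity error `C₁ n^q β^(−a)` is at most half the floor `κ β^(−2) n^(−p)`. -/
theorem xiPowWidening_rigidity_error_le_half_floor {κ C₁ a A'' β n : ℝ} {p q : ℕ} (hκ : 0 < κ) (hC : 0 < C₁)
    (hβ1 : 1 ≤ β) (hn1 : 1 ≤ n) (hn : n ≤ 2 * β ^ A'') (hA'' : A'' * ((p : ℝ) + q) ≤ (a - 2) / 2)
    (hβ₁ : C₁ * 2 ^ (p + q + 1) / κ ≤ β ^ ((a - 2) / 2)) :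
    C₁ * n ^ q * β ^ (-a) ≤ κ / 2 * β ^ (-(2 : ℝ)) / n ^ p := by
  have hβpos : 0 < β := by linarith
  have hn0 : 0 ≤ n := by linarith
  set u : ℝ := β ^ ((a - 2) / 2) with hu
  set w : ℝ := β ^ (-(2 : ℝ)) with hw
  have hupos : 0 < u := Real.rpow_pos_of_pos hβpos _
  have hwpos : 0 < w := Real.rpow_pos_of_pos hβpos _
  have hnp : 0 < n ^ p := pow_pos (by linarith) p
  -- n^(p+q) ≤ 2^(p+q) u
  have hnpq : n ^ (p + q) ≤ 2 ^ (p + q) * u := by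
    calc n ^ (p + q) ≤ (2 * β ^ A'') ^ (p + q) := pow_le_pow_left₀ hn0 hn _
      _ = 2 ^ (p + q) * β ^ (A'' * ((p + q : ℕ) : ℝ)) := by
          rw [mul_pow, Real.rpow_mul_natCast hβpos.le]
      _ ≤ 2 ^ (p + q) * u := by
          refine mul_le_mul_of_nonneg_left ?_ (by positivity)
          refine Real.rpow_le_rpow_of_exponent_le hβ1 ?_
          push_cast
          exact hA''
  -- C₁ 2^(p+q) ≤ (κ/2) u
  have h2 : C₁ * 2 ^ (p + q) ≤ κ / 2 * u := by
    have := (div_le_iff₀ hκ).1 hβ₁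
    rw [pow_succ] at this
    nlinarith
  have h3 : C₁ * n ^ (p + q) ≤ κ / 2 * u * u := by
    have := mul_le_mul_of_nonneg_right h2 hupos.le
    nlinarith [mul_le_mul_of_nonneg_left hnpq hC.le]
  have h4 : C₁ * n ^ (p + q) * w ≤ κ / 2 * w * (u * u) := by
    have := mul_le_mul_of_nonneg_right h3 hwpos.le
    nlinarith
  -- β^(−a) = w / (u u)
  have hβa : β ^ (-a) = w / (u * u) := by
    rw [hw, hu, ← Real.rpow_add hβpos, ← Real.rpow_sub hβpos]
    congr 1
    ring
  rw [le_div_iff₀ hnp, hβa,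
    show C₁ * n ^ q * (w / (u * u)) * n ^ p = C₁ * n ^ (p + q) * w / (u * u) by rw [pow_add]; ring,
    div_le_iff₀ (mul_pos hupos hupos)]
  exact h4

/-- **Support item `FloorOfRigidityAndWitnessG` of route `XiPowWidening` (stmt-QuantumFields-22469), PROVED**: RIGIDITY +
WITNESS + (limit points are translation-invariant DLR states) ⇒ every infinite-volume torus limit point has the floor
`(κ/2) β^(−2) n^(−p)` on the window `1 ≤ n ≤ 2β^{A''}`, `A'' = min (A, A', (a−2)/(2(p+q+1)))`, for all large `β`. -/
theorem xiPowWidening_floorOfRigidityAndWitnessG_proof :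
    Summit.QuantumFields.YangMills.Theses.XiPowWidening.FloorOfRigidityAndWitnessG := by
  intro G _ _ _ _ _hG
  letI : MeasurableSpace G := borel G
  haveI : BorelSpace G := ⟨rfl⟩
  intro r hrig hwit hlp
  obtain ⟨A, C, β₀, a, q, hA, ha, Hrig⟩ := hrig
  obtain ⟨A', κ, β₀', p, hA', hκ, Hwit⟩ := hwit
  set C₁ : ℝ := max C 1 with hC₁
  have hC₁pos : 0 < C₁ := lt_of_lt_of_le zero_lt_one (le_max_right _ _)
  have hCC₁ : C ≤ C₁ := le_max_left _ _
  set s : ℝ := (a - 2) / (2 * ((p : ℝ) + q + 1)) with hs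
  have hspos : 0 < s := by positivity
  set A'' : ℝ := min (min A A') s with hA''
  have hA''pos : 0 < A'' := lt_min (lt_min hA hA') hspos
  have hA''A : A'' ≤ A := (min_le_left _ _).trans (min_le_left _ _)
  have hA''A' : A'' ≤ A' := (min_le_left _ _).trans (min_le_right _ _)
  have hA''s : A'' ≤ s := min_le_right _ _
  have hspq : s * ((p : ℝ) + q) ≤ (a - 2) / 2 := by
    rw [hs, div_mul_eq_mul_div, div_le_div_iff₀ (by positivity) (by norm_num)]
    nlinarith
  have hA''pq : A'' * ((p : ℝ) + q) ≤ (a - 2) / 2 :=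
    (mul_le_mul_of_nonneg_right hA''s (by positivity)).trans hspq
  set base : ℝ := C₁ * 2 ^ (p + q + 1) / κ with hbase
  have hbasepos : 0 < base := by positivity
  set β₁ : ℝ := base ^ (2 / (a - 2)) with hβ₁
  have hβ₁nonneg : 0 ≤ β₁ := Real.rpow_nonneg hbasepos.le _
  refine ⟨A'', κ / 2, max (max β₀ β₀') (max 1 β₁), p, hA''pos, by linarith, ?_⟩
  intro β hβ μ hμ n hn1 hn
  have hβ0 : β₀ ≤ β := ((le_max_left _ _).trans (le_max_left _ _)).trans hβ
  have hβ0' : β₀' ≤ β := ((le_max_right _ _).trans (le_max_left _ _)).trans hβ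
  have hβ1 : (1 : ℝ) ≤ β := ((le_max_left _ _).trans (le_max_right _ _)).trans hβ
  have hββ₁ : β₁ ≤ β := ((le_max_right _ _).trans (le_max_right _ _)).trans hβ
  have hβpos : 0 < β := by linarith
  -- the window inclusions
  have hnA : (n : ℝ) ≤ 2 * β ^ A :=
    hn.trans (mul_le_mul_of_nonneg_left (Real.rpow_le_rpow_of_exponent_le hβ1 hA''A) (by norm_num))
  have hnA' : (n : ℝ) ≤ 2 * β ^ A' :=
    hn.trans (mul_le_mul_of_nonneg_left (Real.rpow_le_rpow_of_exponent_le hβ1 hA''A') (by norm_num))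
  -- the three states
  obtain ⟨hμG, hμinv⟩ := hlp β μ hμ
  have hμP : IsProbabilityMeasure μ := by
    obtain ⟨Lk, -, hla⟩ := hμ
    exact hla.1
  obtain ⟨ν, hνG, hνP, hνinv, hfloor⟩ := Hwit β hβ0' n hn1 hnA'
  have hrig := Hrig β hβ0 μ ν hμG hνG hμP hνP hμinv hνinv n hn1 hnA
  -- the threshold
  have hthr : C₁ * 2 ^ (p + q + 1) / κ ≤ β ^ ((a - 2) / 2) := by
    have h1 : β₁ ^ ((a - 2) / 2) ≤ β ^ ((a - 2) / 2) :=
      Real.rpow_le_rpow hβ₁nonneg hββ₁ (by linarith)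
    have ha2 : a - 2 ≠ 0 := (sub_pos.mpr ha).ne'
    have h2 : β₁ ^ ((a - 2) / 2) = base := by
      rw [hβ₁, ← Real.rpow_mul hbasepos.le, show 2 / (a - 2) * ((a - 2) / 2) = 1 by field_simp, Real.rpow_one]
    rw [← hbase, ← h2]
    exact h1
  have hn1' : (1 : ℝ) ≤ n := by exact_mod_cast hn1
  have hkey := xiPowWidening_rigidity_error_le_half_floor (p := p) (q := q) hκ hC₁pos hβ1 hn1' hn hA''pq hthr
  -- C n^q β^(−a) ≤ C₁ n^q β^(−a)
  have hCle : C * (n : ℝ) ^ q * β ^ (-a) ≤ C₁ * (n : ℝ) ^ q * β ^ (-a) :=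
    mul_le_mul_of_nonneg_right (mul_le_mul_of_nonneg_right hCC₁ (by positivity)) (Real.rpow_nonneg hβpos.le _)
  have habs := (abs_sub_le_iff.1 hrig).2
  -- rpCorr μ ≥ rpCorr ν − C n^q β^(−a) ≥ floor − half floor
  have : κ / 2 * β ^ (-(2 : ℝ)) / (n : ℝ) ^ p =
      κ * β ^ (-(2 : ℝ)) / (n : ℝ) ^ p - κ / 2 * β ^ (-(2 : ℝ)) / (n : ℝ) ^ p := by
    ring
  rw [this]
  linarith

end Summit.QuantumFields.YangMills.Theorems
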